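import Literature.AlgebraicGeometry.Motives.AbelianVarietyPermutationPowerIsotypicalMultiplicity
import HarnessLib

/-!
# Isotypical components of a coset power `A^{G/H}`: `B_W(A^{G/H}) ∼ A^{[ℚ(χ):ℚ] · χ(1) · dim V_χ^H}`, and
# `B_W(A^{G/H}) = 0 ⟺ V_χ^H = 0`

Let `A^{G/H}` be the permutation power of an abelian variety `A` over the coset space of a subgroup `H` of a finite group `G`
(bicone `b` over `(A)_{x ∈ G/H}`, action `ι_x ≫ ρ(g) = ι_{g x}`; the powers of `Motives/AbelianVarietyPermutationPowerReciprocity`,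
`…Mackey`), with isotypical components `B_W = Im u_W` in the vocabulary of `Motives/AbelianVarietyGroupActionIsotypicalDecomposition`
(hypotheses `hc`, `hu`; the class `W ∋ χ` addressed by `he : e = e_ℚ(χ)`, `χ` irreducible of degree `d`).  The isotypical
multiplicities of the coset module are `dim (e_W ℂ[G/H]) = |𝒮(χ)| · χ(1) · ⟨Res_H χ, 1_H⟩_H = [ℚ(χ):ℚ] · d · n` with
`n = ⟨Res_H χ, 1_H⟩_H = dim V_χ^H` (`RepresentationTheory/FiniteGroups/PermutationModuleIsotypicalMultiplicity` §7: `π_{G/H} = Ind_H^G 1_H`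
and Frobenius reciprocity), so by `Motives/AbelianVarietyPermutationPowerIsotypicalMultiplicity`:

* (any field) **`dim B_W(A^{G/H}) = [ℚ(χ):ℚ] · d · n · dim A`**, `rk_ℤ Hom(B_W(A^{G/H}), B) = [ℚ(χ):ℚ] · d · n · rk_ℤ Hom(A, B)`, and the
  VANISHING CRITERION **`B_W(A^{G/H}) = 0 ⟺ dim A = 0 ∨ ⟨Res_H χ, 1_H⟩_H = 0`** — the component of `W` is present exactly when
  `V_χ` has non-zero `H`-invariants (Lange–Rodríguez: "`dim B = 0` if and only if `⟨ρ, W⟩ = 0`", here `⟨ℚ[G/H], W⟩ ∝ dim V_χ^H`);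
* (perfect field) **`B_W(A^{G/H}) ∼ A^{[ℚ(χ):ℚ] · d · n}`**.

`H = 1` is the regular power (`Motives/AbelianVarietyPermutationPowerRegular`, `n = d`), `H = G` the point (`n = δ_{χ,1}`).
Everything is a theorem (no definitions); `n` enters through the hypothesis `hn : ⟨Res_H χ, 1_H⟩_H = n`.

## References

* [Isaacs1976] I. M. Isaacs, *Character Theory of Finite Groups* (1976), Lemma 5.14 (`(1_H)^G` is the permutation character on cosets).
* [SerreLinearRepresentations1977] J.-P. Serre, *Linear Representations of Finite Groups*, GTM 42 (1977), §7.2 Thm. 13 (Frobenius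
  reciprocity), §2.6 Thm. 8, §3.3.
* [LangeRodriguez2022] H. Lange, R. E. Rodríguez, *Decomposition of Jacobians by Prym Varieties*, LNM 2310 (2022), §2.9.1 Thm. 2.9.1,
  Prop. 2.9.3 (PDF pp. 43, 46).
* [LangeRecillas2004] H. Lange, S. Recillas, *Abelian varieties with group action*, J. reine angew. Math. 575 (2004), §1 Prop. 1.1.
-/

noncomputable section

open CategoryTheory CategoryTheory.Limits MulAction
open Literature.NumberTheory.DiophantineGeometry
open Literature.RepresentationTheory.FiniteGroups

universe u

namespace Literature.AlgebraicGeometry.Motives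

namespace AbelianVariety

variable {K : Type u} [Field K] {A : AbelianVariety K} {G : Type} [Group G] [Fintype G] (H : Subgroup G) [Fintype H]
  [Fintype (G ⧸ H)] (b : Bicone (fun _ : G ⧸ H ↦ A)) (ρ : G →* End b.pt) {c : ratCharIdempotents G → G → ℤ}
  (hc : ∀ e : ratCharIdempotents G,
    (Fintype.card G : ℚ) • (e : MonoidAlgebra ℚ G) = ∑ g, (c e g : ℚ) • MonoidAlgebra.of ℚ G g)
  {u : ratCharIdempotents G → (b.pt ⟶ b.pt)} (hu : ∀ e, End.of (u e) = ∑ g, c e g • ρ g)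

include hc hu

/-! ## §1 Any field -/

/-- **`dim B_W(A^{G/H}) = [ℚ(χ):ℚ] · d · n · dim A`** with `χ(1) = d`, `⟨Res_H χ, 1_H⟩_H = n` (`= dim V_χ^H`); any field.
[cite: Isaacs1976, Lemma 5.14] [cite: SerreLinearRepresentations1977, §7.2 Thm. 13 and §2.6 Thm. 8 (ii)] [cite: LangeRodriguez2022, §2.9.1 Prop. 2.9.3 (PDF p. 46)] -/
theorem dim_isotypical_cosetPower_eq (hb : ∑ x, b.π x ≫ b.ι x = 𝟙 b.pt)
    (hρ : ∀ (g : G) (x : G ⧸ H), b.ι x ≫ End.asHom (ρ g) = b.ι (g • x)) (e : ratCharIdempotents G) {χ : G → ℂ}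
    (hχ : IsIrrChar G χ) (he : (e : MonoidAlgebra ℚ G) = ratCharIdempotent χ) {d n : ℕ} (hd : χ 1 = d)
    (hn : classInner (fun h : H ↦ χ h) 1 = n) :
    (image (u e)).dim = Module.finrank ℚ (charField χ) * d * n * A.dim := by
  rw [dim_isotypical_permAction_eq_finrank_mul b ρ hc hu hb hρ e, he,
    finrank_range_quotient_ratCharIdempotent_eq_finrank_charField_mul H hχ hd hn]

/-- **`rk_ℤ Hom(B_W(A^{G/H}), B) = [ℚ(χ):ℚ] · d · n · rk_ℤ Hom(A, B)`** for every `B` (any field).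
[cite: Isaacs1976, Lemma 5.14] [cite: SerreLinearRepresentations1977, §7.2 Thm. 13] [cite: LangeRodriguez2022, §2.9.1 Thm. 2.9.1 (PDF p. 43)] -/
theorem finrank_hom_isotypical_cosetPower_eq (B : AbelianVariety K) (hb : ∑ x, b.π x ≫ b.ι x = 𝟙 b.pt)
    (hρ : ∀ (g : G) (x : G ⧸ H), b.ι x ≫ End.asHom (ρ g) = b.ι (g • x)) (e : ratCharIdempotents G) {χ : G → ℂ}
    (hχ : IsIrrChar G χ) (he : (e : MonoidAlgebra ℚ G) = ratCharIdempotent χ) {d n : ℕ} (hd : χ 1 = d)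
    (hn : classInner (fun h : H ↦ χ h) 1 = n) :
    Module.finrank ℤ (image (u e) ⟶ B) = Module.finrank ℚ (charField χ) * d * n * Module.finrank ℤ (A ⟶ B) := by
  rw [finrank_hom_isotypical_permAction_eq_finrank_mul b ρ hc hu B hb hρ e, he,
    finrank_range_quotient_ratCharIdempotent_eq_finrank_charField_mul H hχ hd hn]

/-- **VANISHING CRITERION `B_W(A^{G/H}) = 0 ⟺ dim A = 0 ∨ ⟨Res_H χ, 1_H⟩_H = 0`** (any field): for `A ≠ 0` the component of the class
of `χ` in `A ⊗ ℤ[G/H]` is present exactly when `V_χ^H ≠ 0` ("`dim B = 0` if and only if `⟨ρ, W⟩ = 0`").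
[cite: LangeRodriguez2022, §2.9.1 Thm. 2.9.1 and Prop. 2.9.3 (ii) (PDF pp. 43, 46)] [cite: SerreLinearRepresentations1977, §7.2 Thm. 13] -/
theorem dim_isotypical_cosetPower_eq_zero_iff (hb : ∑ x, b.π x ≫ b.ι x = 𝟙 b.pt)
    (hρ : ∀ (g : G) (x : G ⧸ H), b.ι x ≫ End.asHom (ρ g) = b.ι (g • x)) (e : ratCharIdempotents G) {χ : G → ℂ}
    (hχ : IsIrrChar G χ) (he : (e : MonoidAlgebra ℚ G) = ratCharIdempotent χ) :
    (image (u e)).dim = 0 ↔ A.dim = 0 ∨ classInner (fun h : H ↦ χ h) 1 = 0 := by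
  rw [dim_isotypical_permAction_eq_zero_iff_finrank b ρ hc hu hb hρ e, he]
  have key : Module.finrank ℂ (LinearMap.range ((Representation.ofMulAction ℂ G (G ⧸ H)).asAlgebraHom
      (MonoidAlgebra.mapRingHom G (algebraMap ℚ ℂ) (ratCharIdempotent χ)))) = 0 ↔ classInner (fun h : H ↦ χ h) 1 = 0 := by
    rw [← Nat.cast_eq_zero (R := ℂ), finrank_range_quotient_ratCharIdempotent_eq H hχ, mul_eq_zero, mul_eq_zero,
      Nat.cast_eq_zero, Finset.card_eq_zero]
    have hne : galoisClass χ ≠ ∅ := Finset.ne_empty_of_mem (mem_galoisClass_iff.2 (IsGaloisConj.refl χ))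
    have h1 : χ 1 ≠ 0 := hχ.apply_one_ne_zero
    tauto
  rw [key]

/-! ## §2 Perfect field -/

section Isogeny

variable [PerfectField K]

/-- **`B_W(A^{G/H}) ∼ A^{[ℚ(χ):ℚ] · d · n}`** over a perfect field (`χ(1) = d`, `⟨Res_H χ, 1_H⟩_H = n = dim V_χ^H`).
[cite: LangeRodriguez2022, §2.9.1 Thm. 2.9.1 and Prop. 2.9.3 (PDF pp. 43, 46)] [cite: LangeRecillas2004, §1 Prop. 1.1]
[cite: SerreLinearRepresentations1977, §7.2 Thm. 13 and §2.6 Thm. 8 (ii)] -/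
theorem isIsogenous_isotypical_cosetPower_biproduct (hb : ∑ x, b.π x ≫ b.ι x = 𝟙 b.pt)
    (hρ : ∀ (g : G) (x : G ⧸ H), b.ι x ≫ End.asHom (ρ g) = b.ι (g • x)) (e : ratCharIdempotents G) {χ : G → ℂ}
    (hχ : IsIrrChar G χ) (he : (e : MonoidAlgebra ℚ G) = ratCharIdempotent χ) {d n : ℕ} (hd : χ 1 = d)
    (hn : classInner (fun h : H ↦ χ h) 1 = n) :
    IsIsogenous (image (u e)) (⨁ fun _ : Fin (Module.finrank ℚ (charField χ) * d * n) ↦ A) := by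
  refine isIsogenous_iff_forall_finrank_hom_eq'.2 fun B ↦ ?_
  rw [finrank_hom_isotypical_cosetPower_eq H b ρ hc hu B hb hρ e hχ he hd hn, finrank_hom_biproduct_const, Fintype.card_fin]

end Isogeny

end AbelianVariety

end Literature.AlgebraicGeometry.Motives
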